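import Summits.FinalStateConjecture.FinalStateConjecture.Theses.LapseTrumpetKID
import HarnessLib

/-!
# Birth skeleton — crux stmt-FinalStateConjecture-17998 `Theses.LapseTrumpetKID.MaximalCensorship` (rank 2)
# line `birth` (skeleton registrar planner-skel-stmt-FinalStateConjecture-17998-0, 2026-08-17; BC3 of run/shared/lean/lens3/_common/BC.md)

The crux (the route's ONE generic clause): for every connected Hausdorff second-countable smooth
`3`-manifold `X`, the property `P(D)` = "an MGHD exists ∧ every MGHD `𝒟` (i) has complete `𝓘⁺`,
(ii) carries a NORMALISED MAXIMAL CAUCHY FOLIATION `(F, ν)` (smooth `F : ℝ × X → 𝒟`, every leaf a smooth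
embedding of `X` onto a Cauchy hypersurface with induced data maximal, complete, AF of order 1 on a sole
end; lapse `N = −g(∂ₜF, ν) > 0`, `N(t,·) → 1` cocompactly for `t ≥ 0`) (iii) whose LAPSE WELLS ARE TRAPPED
(`∃ ε > 0, t₀`: for `t ≥ t₀` a point with `N < ε` cannot causally reach the region `N > 1 − ε` of any
later leaf)" is TAME Christodoulou-generic of codimension `≥ 1` in `admissibleVacuumData X`.

THE CUT (the route header's own two-layer plan for this node, `MaximalCensorship ⇐ MaximalWCC →
SingularityAvoidance → TrappedWellsGeneric`, re-typed along the one seam logic allows: tame genericity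
`IsTameChristodoulouGeneric 𝓓 · 1` is MONOTONE in the property but NOT closed under `∧`, so every
decomposition of `generic(P)` has the shape `generic(Q)` + POINTWISE `Q → P` on the admissible class; all
genuinely generic content — weak cosmic censorship AND the censorship of lapse wells, which fails exactly
at (believed non-generic) extremal remnants — must ride in ONE generic stub, and the gauge-existence
content — which is deterministic PDE/geometry: one maximal Cauchy leaf (elliptic, Bartnik) and its
eternal propagation (hyperbolic–elliptic, singularity avoidance / collapse of the lapse) — is pointwise):

* `stub_wellCensorshipGeneric` (K, GENERIC; open-problem sized — contains tame-generic WCC): for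
  tame-generic admissible `D`: an MGHD exists and every MGHD has complete `𝓘⁺` AND EVERY normalised
  maximal Cauchy foliation `(F, ν)` of it (clause (ii) verbatim, now a HYPOTHESIS) has trapped wells
  (clause (iii) verbatim).  No existence of the gauge is asserted: this is the pure censorship content
  (horizons hide both the singular future — complete `𝓘⁺` — and the loci where maximal time freezes).
  Why it might fail: ¬WCC on a set of data not escapable along tame immersed curves on the fixed end;
  or a GENERIC mechanism producing untrapped wells (extremal / near-extremal remnants surviving on an
  open set of data — the third law failing generically, cf. Kehle–Unger; or late maximal leaves of
  sub-extremal Kerr developments dipping to small lapse OUTSIDE the horizon).  Sources: Christodoulou1999,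
  arXiv:1710.01722, arXiv:0811.0354, arXiv:2211.15742, doi:10.1103/PhysRevD.57.4728.
* `stub_maximalCauchyLeaf` (L, POINTWISE; L/open — Bartnik-type existence): every MGHD with complete
  `𝓘⁺` of EVERY admissible datum contains one complete, maximal (`tr k = 0`), asymptotically flat
  (order 1, sole end) Cauchy hypersurface `f : X → 𝒟` with future unit normal (the `t`-slice of clause
  (ii), verbatim).  Why it might fail: it inherits VERBATIM the crux's flagged `∀ X` defect (item
  why-might-fail 2026-08-16; grounder g72-2, 2026-08-17: on `X = T³ ∖ {p}` admissible vacuum data exist,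
  IMP gr-qc/0206034 Thm 1 / Witt PRL 57 (1986) 1386, yet `R = |k|² ≥ 0` forbids a complete AF maximal leaf `≅ X`), so on such `X`
  it is false whenever `𝓓(X) ≠ ∅` — exactly as the crux is; the REPAIRABLE re-audit's restatement of the
  crux (topology-robust leaf class / `X ≅ ℝ³`) restates L the same way.  On `X ≅ ℝ³`: Bartnik's interior
  condition must be verified from complete `𝓘⁺` alone (the leaf has to thread between the data and the
  singular/Cauchy-horizon boundary of the MGHD).  Sources: doi:10.1007/bf01209300 (Bartnik 1984, Thm 4.1),
  doi:10.1007/BF02102106 (Chruściel–Wald 1994), arXiv:gr-qc/0206034, doi:10.1103/PhysRevLett.57.1386.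
* `stub_maximalLeafPropagates` (A, POINTWISE; open-problem sized — singularity avoidance of the maximal
  gauge): in an MGHD with complete `𝓘⁺` of an admissible datum, ONE such leaf propagates to an ETERNAL
  normalised maximal Cauchy foliation (clause (ii) verbatim: all `t ∈ ℝ`, `N > 0`, `N(t,·) → 1` for
  `t ≥ 0`; the past half is a reparametrised local foliation, the future half is the Moncrief–Eardley
  programme: the leaves avoid the singular boundary and pile up on limit maximal cylinders inside the
  holes).  Why it might fail: proved only for Schwarzschild / crushing singularities (Eardley–Smarr,
  Beig–Ó Murchadha `r = 3M/2`); for Kerr `a ≠ 0` interiors the leaves must stay off the Cauchy horizon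
  for all `t` with complete AF geometry — open even for exact Kerr developments; the lapse equation
  `ΔN = |k|²N`, `N → 1` needs the leafwise elliptic theory uniformly in `t`.  Sources:
  doi:10.1103/PhysRevD.19.2239 (Eardley–Smarr 1979), doi:10.1103/PhysRevD.57.4728 (Beig–Ó Murchadha 1998),
  arXiv:gr-qc/9608045 (Rendall), ChristodoulouKlainerman1993, doi:10.1007/bf01209300.

Composition `MaximalCensorship_of : Goal.stub_wellCensorshipGeneric → Goal.stub_maximalCauchyLeaf →
Goal.stub_maximalLeafPropagates → MaximalCensorship` is the monotonicity transport (K's tame immersed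
injective admissible curve through a crux-exceptional datum serves verbatim, because pointwise on the
admissible class L and A produce the foliation and K's `∀`-clause traps its wells), and
`MaximalCensorship_proof : MaximalCensorship` is the crux BY NAME modulo the three stubs.
No stub is cheaply the crux or the summit: K lacks gauge existence, L and A lack genericity/censorship and
are not implied by `generic(P)` (tame codimension says nothing about a fixed datum); BC3 probes
(`stub → MaximalCensorship`, `stub → FinalStateConjecture` by `first | exact? | simpa | unfold; simpa | aesop`,
400 000 heartbeats, files importing the route file only) all six FAIL (rc 1), and each alternative run
ALONE fails too (`exact?`/`intro h; exact?`: could not close the goal; `aesop`: failed after exhaustive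
search; `simpa`, `unfold; simpa`: heartbeat exhaustion) — 6 + 30 probes, log in `Lines/birth.md`.
Disproof.lean: none exists for this crux at registration (`ledger crux ls` empty; no `_false_without_`
obligations).  Negatives index: no entry bears on maximal foliations / these stubs.
-/

set_option linter.dupNamespace false

noncomputable section

open scoped Manifold ContDiff Topology
open Filter Set Function Literature.Geometry.Lorentzian

namespace Summit.FinalStateConjecture.FinalStateConjecture.Cruxes.MaximalCensorship.Birth

open Summit.FinalStateConjecture.FinalStateConjecture.Theses.LapseTrumpetKID (MaximalCensorship)

/-! ## Legend: the three stub statements as named propositions (verbatim the registered signatures)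
The skeleton audit reads the hypotheses of `MaximalCensorship_of` BY NAME: each head `Goal.stub_<x>` is
the statement of the declared stub `stub_<x>` (same short name; `Goal.stub_<x>` and the type of
`stub_<x>` are syntactically identical, see the `goal_<x>_holds` consistency lemmas at the end). -/

/-- Statement of `stub_wellCensorshipGeneric` (K): tame-generic( MGHD exists ∧ every MGHD has complete `𝓘⁺` ∧
EVERY normalised maximal Cauchy foliation of it has trapped lapse wells ). -/
def Goal.stub_wellCensorshipGeneric : Prop :=
  open Literature.Geometry.Lorentzian in ∀ (X : Type) [TopologicalSpace X] [ChartedSpace E3 X] [IsManifold (𝓡 3) (⊤ : ℕ∞) X] [T2Space X] [SecondCountableTopology X] [ConnectedSpace X], InitialDataSet.IsTameChristodoulouGeneric (admissibleVacuumData X) (fun D ↦ (∃ 𝒟 : VacuumCauchyDevelopment D, 𝒟.IsMaximal) ∧ ∀ 𝒟 : VacuumCauchyDevelopment D, 𝒟.IsMaximal → Summit.FinalStateConjecture.HasCompleteNullInfinity 𝒟.toCauchyDevelopment ∧ ∀ (F : ℝ × X → 𝒟.carrier) (ν : ∀ t : ℝ, NormalField (𝓡 4) (fun x : X ↦ F (t,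 x))), (ContMDiff (𝓘(ℝ, ℝ).prod (𝓡 3)) (𝓡 4) (⊤ : ℕ∞) F ∧ (∀ t, Manifold.IsSmoothEmbedding (𝓡 3) (𝓡 4) (⊤ : ℕ∞) (fun x ↦ F (t, x))) ∧ (∀ t, 𝒟.metric.IsCauchyHypersurface 𝒟.timeOrientation (range fun x ↦ F (t, x))) ∧ (∀ t, 𝒟.metric.IsFutureUnitNormal (𝓡 3) 𝒟.timeOrientation (fun x ↦ F (t, x)) (ν t)) ∧ (∀ t, ∃ Dt : InitialDataSet (𝓡 3) X, (∀ (x : X) (v w : TangentSpace (𝓡 3) x), Dt.h.inner x v w = 𝒟.metric.val (F (t, x)) (mfderiv (𝓡 3) (𝓡 4) (fun y ↦ F (t, y)) x v) (mfderiv (𝓡 3) (𝓡 4) (fun y ↦ F (t, y)) x w)) ∧ (∀ [𝒟.metric.toPseudoRiemannianMetric.HasLeviCivita] (x : X), 𝒟.metric.toPseudoRiemannianMetric.secondFundamentalForm (𝓡 3) (fun y ↦ F (t, y)) (ν t) x = Dt.kBilin x) ∧ Dt.IsMaximalData ∧ (∀ [Dt.metric.HasLeviCivita], Dt.IsComplete)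 ∧ ∃ e : AFEnd X, e.IsSoleEnd ∧ e.IsAsymptoticallyFlat Dt 1) ∧ (∀ t x, 0 < - 𝒟.metric.val (F (t, x)) (mfderiv 𝓘(ℝ, ℝ) (𝓡 4) (fun s : ℝ ↦ F (s, x)) t 1) (ν t x)) ∧ (∀ t, 0 ≤ t → Tendsto (fun x ↦ - 𝒟.metric.val (F (t, x)) (mfderiv 𝓘(ℝ, ℝ) (𝓡 4) (fun s : ℝ ↦ F (s, x)) t 1) (ν t x)) (cocompact X) (𝓝 1))) → (∃ ε : ℝ, 0 < ε ∧ ∃ t₀ : ℝ, ∀ (t : ℝ) (x : X), t₀ ≤ t → - 𝒟.metric.val (F (t, x)) (mfderiv 𝓘(ℝ, ℝ) (𝓡 4) (fun s : ℝ ↦ F (s, x)) t 1) (ν t x) < ε → ∀ (t' : ℝ) (x' : X), t ≤ t' → 1 - ε < - 𝒟.metric.val (F (t', x')) (mfderiv 𝓘(ℝ, ℝ) (𝓡 4) (fun s : ℝ ↦ F (s, x')) t' 1) (ν t' x') → F (t', x') ∉ 𝒟.metric.causalFuture 𝒟.timeOrientation {F (t, x)})) 1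

/-- Statement of `stub_maximalCauchyLeaf` (L): pointwise, every MGHD with complete `𝓘⁺` of an admissible datum
contains one complete maximal AF (order 1, sole end) Cauchy leaf `≅ X` with future unit normal. -/
def Goal.stub_maximalCauchyLeaf : Prop :=
  open Literature.Geometry.Lorentzian in ∀ (X : Type) [TopologicalSpace X] [ChartedSpace E3 X] [IsManifold (𝓡 3) (⊤ : ℕ∞) X] [T2Space X] [SecondCountableTopology X] [ConnectedSpace X] (D : InitialDataSet (𝓡 3) X), D ∈ admissibleVacuumData X → ∀ 𝒟 : VacuumCauchyDevelopment D, 𝒟.IsMaximal → Summit.FinalStateConjecture.HasCompleteNullInfinity 𝒟.toCauchyDevelopment → ∃ (f : X → 𝒟.carrier) (νf : NormalField (𝓡 4) f), Manifold.IsSmoothEmbedding (𝓡 3) (𝓡 4) (⊤ : ℕ∞) f ∧ 𝒟.metric.IsCauchyHypersurface 𝒟.timeOrientation (range f) ∧ 𝒟.metric.IsFutureUnitNormal (𝓡 3) 𝒟.timeOrientation f νf ∧ ∃ Df : InitialDataSet (𝓡 3) X, (∀ (x : X) (v w : TangentSpace (𝓡 3) x), Df.h.inner x v w = 𝒟.metric.val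 (f x) (mfderiv (𝓡 3) (𝓡 4) f x v) (mfderiv (𝓡 3) (𝓡 4) f x w)) ∧ (∀ [𝒟.metric.toPseudoRiemannianMetric.HasLeviCivita] (x : X), 𝒟.metric.toPseudoRiemannianMetric.secondFundamentalForm (𝓡 3) f νf x = Df.kBilin x) ∧ Df.IsMaximalData ∧ (∀ [Df.metric.HasLeviCivita], Df.IsComplete) ∧ ∃ e : AFEnd X, e.IsSoleEnd ∧ e.IsAsymptoticallyFlat Df 1

/-- Statement of `stub_maximalLeafPropagates` (A): pointwise, one such leaf propagates to an eternal normalised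
maximal Cauchy foliation (clause (ii) of the crux verbatim). -/
def Goal.stub_maximalLeafPropagates : Prop :=
  open Literature.Geometry.Lorentzian in ∀ (X : Type) [TopologicalSpace X] [ChartedSpace E3 X] [IsManifold (𝓡 3) (⊤ : ℕ∞) X] [T2Space X] [SecondCountableTopology X] [ConnectedSpace X] (D : InitialDataSet (𝓡 3) X), D ∈ admissibleVacuumData X → ∀ 𝒟 : VacuumCauchyDevelopment D, 𝒟.IsMaximal → Summit.FinalStateConjecture.HasCompleteNullInfinity 𝒟.toCauchyDevelopment → (∃ (f : X → 𝒟.carrier) (νf : NormalField (𝓡 4) f), Manifold.IsSmoothEmbedding (𝓡 3) (𝓡 4) (⊤ : ℕ∞) f ∧ 𝒟.metric.IsCauchyHypersurface 𝒟.timeOrientation (range f) ∧ 𝒟.metric.IsFutureUnitNormal (𝓡 3) 𝒟.timeOrientation f νf ∧ ∃ Df : InitialDataSet (𝓡 3) X, (∀ (x : X) (v w : TangentSpace (𝓡 3) x), Df.h.inner x v w = 𝒟.metric.val (f x) (mfderiv (𝓡 3) (𝓡 4) f x v) (mfderiv (𝓡 3) (𝓡 4) f x w)) ∧ (∀ [𝒟.metric.toPseudoRiemannianMetric.HasLeviCivita]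 (x : X), 𝒟.metric.toPseudoRiemannianMetric.secondFundamentalForm (𝓡 3) f νf x = Df.kBilin x) ∧ Df.IsMaximalData ∧ (∀ [Df.metric.HasLeviCivita], Df.IsComplete) ∧ ∃ e : AFEnd X, e.IsSoleEnd ∧ e.IsAsymptoticallyFlat Df 1) → ∃ (F : ℝ × X → 𝒟.carrier) (ν : ∀ t : ℝ, NormalField (𝓡 4) (fun x : X ↦ F (t, x))), (ContMDiff (𝓘(ℝ, ℝ).prod (𝓡 3)) (𝓡 4) (⊤ : ℕ∞) F ∧ (∀ t, Manifold.IsSmoothEmbedding (𝓡 3) (𝓡 4) (⊤ : ℕ∞) (fun x ↦ F (t, x))) ∧ (∀ t, 𝒟.metric.IsCauchyHypersurface 𝒟.timeOrientation (range fun x ↦ F (t, x))) ∧ (∀ t, 𝒟.metric.IsFutureUnitNormal (𝓡 3) 𝒟.timeOrientation (fun x ↦ F (t, x)) (ν t)) ∧ (∀ t, ∃ Dt : InitialDataSet (𝓡 3) X, (∀ (x : X) (v w : TangentSpace (𝓡 3) x), Dt.h.inner x v w = 𝒟.metric.val (F (t, x)) (mfderiv (𝓡 3) (𝓡 4) (fun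 y ↦ F (t, y)) x v) (mfderiv (𝓡 3) (𝓡 4) (fun y ↦ F (t, y)) x w)) ∧ (∀ [𝒟.metric.toPseudoRiemannianMetric.HasLeviCivita] (x : X), 𝒟.metric.toPseudoRiemannianMetric.secondFundamentalForm (𝓡 3) (fun y ↦ F (t, y)) (ν t) x = Dt.kBilin x) ∧ Dt.IsMaximalData ∧ (∀ [Dt.metric.HasLeviCivita], Dt.IsComplete) ∧ ∃ e : AFEnd X, e.IsSoleEnd ∧ e.IsAsymptoticallyFlat Dt 1) ∧ (∀ t x, 0 < - 𝒟.metric.val (F (t, x)) (mfderiv 𝓘(ℝ, ℝ) (𝓡 4) (fun s : ℝ ↦ F (s, x)) t 1) (ν t x)) ∧ (∀ t, 0 ≤ t → Tendsto (fun x ↦ - 𝒟.metric.val (F (t, x)) (mfderiv 𝓘(ℝ, ℝ) (𝓡 4) (fun s : ℝ ↦ F (s, x)) t 1) (ν t x)) (cocompact X) (𝓝 1)))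

/-! ## Registered stubs (`sorry` only here; signatures def-free and self-contained) -/

/-- **K — CENSORSHIP OF LAPSE WELLS, GENERIC (the one generic stub).**  For every connected Hausdorff
second-countable smooth `3`-manifold `X`, the property "an MGHD exists, and every MGHD `𝒟` has complete
`𝓘⁺` and traps the lapse wells of EVERY normalised maximal Cauchy foliation `(F, ν)` it carries —
`F : ℝ × X → 𝒟` smooth, each `F(t,·)` a smooth embedding onto a Cauchy hypersurface with future unit normal
`ν t`, induced `(h, k)` those of a maximal, complete InitialDataSet on `X`, AF of order 1 on a sole end,
lapse `N = −g(∂ₜF, ν) > 0`, `N(t,·) → 1` cocompactly for `t ≥ 0` ⟹ `∃ ε > 0, t₀` with: `t ≥ t₀`,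
`N(t,x) < ε`, `t' ≥ t`, `N(t',x') > 1 − ε` ⟹ `F(t',x') ∉ J⁺(F(t,x))`" is tame Christodoulou-generic of
codimension `≥ 1` in `admissibleVacuumData X`.  Weak cosmic censorship plus "where maximal time stops is
inside a black hole", with NO assertion that the gauge exists.  Why it might fail: ¬WCC off a tame-thin
set; generic untrapped wells (third law failing on an open set of data; exterior lapse dips on late
maximal leaves of sub-extremal developments).  Sources: Christodoulou1999, arXiv:1710.01722,
arXiv:0811.0354, arXiv:2211.15742, doi:10.1103/PhysRevD.57.4728.  Size: open-problem. -/
theorem stub_wellCensorshipGeneric : open Literature.Geometry.Lorentzian in ∀ (X : Type) [TopologicalSpace X] [ChartedSpace E3 X] [IsManifold (𝓡 3) (⊤ : ℕ∞) X] [T2Space X] [SecondCountableTopology X] [ConnectedSpace X], InitialDataSet.IsTameChristodoulouGeneric (admissibleVacuumData X) (fun D ↦ (∃ 𝒟 : VacuumCauchyDevelopment D, 𝒟.IsMaximal) ∧ ∀ 𝒟 : VacuumCauchyDevelopment D, 𝒟.IsMaximal → Summit.FinalStateConjecture.HasCompleteNullInfinity 𝒟.toCauchyDevelopment ∧ ∀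 (F : ℝ × X → 𝒟.carrier) (ν : ∀ t : ℝ, NormalField (𝓡 4) (fun x : X ↦ F (t, x))), (ContMDiff (𝓘(ℝ, ℝ).prod (𝓡 3)) (𝓡 4) (⊤ : ℕ∞) F ∧ (∀ t, Manifold.IsSmoothEmbedding (𝓡 3) (𝓡 4) (⊤ : ℕ∞) (fun x ↦ F (t, x))) ∧ (∀ t, 𝒟.metric.IsCauchyHypersurface 𝒟.timeOrientation (range fun x ↦ F (t, x))) ∧ (∀ t, 𝒟.metric.IsFutureUnitNormal (𝓡 3) 𝒟.timeOrientation (fun x ↦ F (t, x)) (ν t)) ∧ (∀ t, ∃ Dt : InitialDataSet (𝓡 3) X, (∀ (x : X) (v w : TangentSpace (𝓡 3) x), Dt.h.inner x v w = 𝒟.metric.val (F (t, x)) (mfderiv (𝓡 3) (𝓡 4) (fun y ↦ F (t, y)) x v) (mfderiv (𝓡 3) (𝓡 4) (fun y ↦ F (t, y)) x w)) ∧ (∀ [𝒟.metric.toPseudoRiemannianMetric.HasLeviCivita] (x : X), 𝒟.metric.toPseudoRiemannianMetric.secondFundamentalForm (𝓡 3) (fun y ↦ F (t, y)) (ν t)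 x = Dt.kBilin x) ∧ Dt.IsMaximalData ∧ (∀ [Dt.metric.HasLeviCivita], Dt.IsComplete) ∧ ∃ e : AFEnd X, e.IsSoleEnd ∧ e.IsAsymptoticallyFlat Dt 1) ∧ (∀ t x, 0 < - 𝒟.metric.val (F (t, x)) (mfderiv 𝓘(ℝ, ℝ) (𝓡 4) (fun s : ℝ ↦ F (s, x)) t 1) (ν t x)) ∧ (∀ t, 0 ≤ t → Tendsto (fun x ↦ - 𝒟.metric.val (F (t, x)) (mfderiv 𝓘(ℝ, ℝ) (𝓡 4) (fun s : ℝ ↦ F (s, x)) t 1) (ν t x)) (cocompact X) (𝓝 1))) → (∃ ε : ℝ, 0 < ε ∧ ∃ t₀ : ℝ, ∀ (t : ℝ) (x : X), t₀ ≤ t → - 𝒟.metric.val (F (t, x)) (mfderiv 𝓘(ℝ, ℝ) (𝓡 4) (fun s : ℝ ↦ F (s, x)) t 1) (ν t x) < ε → ∀ (t' : ℝ) (x' : X), t ≤ t' → 1 - ε < - 𝒟.metric.val (F (t', x')) (mfderiv 𝓘(ℝ, ℝ) (𝓡 4) (fun s : ℝ ↦ F (s, x')) t' 1) (ν t' x')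 → F (t', x') ∉ 𝒟.metric.causalFuture 𝒟.timeOrientation {F (t, x)})) 1 := by
  sorry

/-- **L — ONE MAXIMAL CAUCHY LEAF (pointwise, Bartnik-type).**  For every admissible datum `D` on `X`, every
maximal vacuum Cauchy development `𝒟` of `D` with complete `𝓘⁺` contains a smooth embedding `f : X → 𝒟`
onto a Cauchy hypersurface, with future unit normal field `νf`, whose induced first and second fundamental
forms are those of an InitialDataSet on `X` that is maximal (`tr k = 0`), complete, and asymptotically flat
of order 1 on a sole end.  Why it might fail: inherits the crux's flagged `∀ X` topology defect verbatim
(non-PSC `X = T³ ∖ {p}` carry admissible data but no complete AF maximal leaf, `R = |k|² ≥ 0`); on `ℝ³`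
Bartnik's interior condition must come from complete `𝓘⁺` alone.  Sources: doi:10.1007/bf01209300,
doi:10.1007/BF02102106, arXiv:gr-qc/0206034, doi:10.1103/PhysRevLett.57.1386.  Size: L / open. -/
theorem stub_maximalCauchyLeaf : open Literature.Geometry.Lorentzian in ∀ (X : Type) [TopologicalSpace X] [ChartedSpace E3 X] [IsManifold (𝓡 3) (⊤ : ℕ∞) X] [T2Space X] [SecondCountableTopology X] [ConnectedSpace X] (D : InitialDataSet (𝓡 3) X), D ∈ admissibleVacuumData X → ∀ 𝒟 : VacuumCauchyDevelopment D, 𝒟.IsMaximal → Summit.FinalStateConjecture.HasCompleteNullInfinity 𝒟.toCauchyDevelopment → ∃ (f : X → 𝒟.carrier) (νf : NormalField (𝓡 4) f), Manifold.IsSmoothEmbedding (𝓡 3) (𝓡 4) (⊤ : ℕ∞) f ∧ 𝒟.metric.IsCauchyHypersurface 𝒟.timeOrientation (range f) ∧ 𝒟.metric.IsFutureUnitNormal (𝓡 3) 𝒟.timeOrientation f νf ∧ ∃ Df : InitialDataSet (𝓡 3) X, (∀ (x : X) (v w : TangentSpace (𝓡 3) x), Df.h.inner x v w = 𝒟.metric.val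 (f x) (mfderiv (𝓡 3) (𝓡 4) f x v) (mfderiv (𝓡 3) (𝓡 4) f x w)) ∧ (∀ [𝒟.metric.toPseudoRiemannianMetric.HasLeviCivita] (x : X), 𝒟.metric.toPseudoRiemannianMetric.secondFundamentalForm (𝓡 3) f νf x = Df.kBilin x) ∧ Df.IsMaximalData ∧ (∀ [Df.metric.HasLeviCivita], Df.IsComplete) ∧ ∃ e : AFEnd X, e.IsSoleEnd ∧ e.IsAsymptoticallyFlat Df 1 := by
  sorry

/-- **A — A MAXIMAL LEAF PROPAGATES ETERNALLY (pointwise; singularity avoidance of the maximal gauge).**  For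
every admissible datum, every MGHD `𝒟` with complete `𝓘⁺`: if `𝒟` contains one complete maximal AF Cauchy
leaf `≅ X` (L's conclusion), then `𝒟` carries a normalised maximal Cauchy foliation `(F, ν)` in the sense
of clause (ii) of the crux, verbatim (all `t ∈ ℝ`; `N > 0`; `N(t,·) → 1` cocompactly for `t ≥ 0`).
The Moncrief–Eardley programme: maximal leaves avoid the singular boundary of the MGHD and exist for all
proper-time-at-infinity.  Why it might fail: known only for Schwarzschild-like (crushing) interiors; Kerr
`a ≠ 0` leaves must avoid the Cauchy horizon forever; uniform leafwise elliptic theory for the lapse.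
Sources: doi:10.1103/PhysRevD.19.2239, doi:10.1103/PhysRevD.57.4728, arXiv:gr-qc/9608045,
ChristodoulouKlainerman1993, doi:10.1007/bf01209300.  Size: open-problem. -/
theorem stub_maximalLeafPropagates : open Literature.Geometry.Lorentzian in ∀ (X : Type) [TopologicalSpace X] [ChartedSpace E3 X] [IsManifold (𝓡 3) (⊤ : ℕ∞) X] [T2Space X] [SecondCountableTopology X] [ConnectedSpace X] (D : InitialDataSet (𝓡 3) X), D ∈ admissibleVacuumData X → ∀ 𝒟 : VacuumCauchyDevelopment D, 𝒟.IsMaximal → Summit.FinalStateConjecture.HasCompleteNullInfinity 𝒟.toCauchyDevelopment → (∃ (f : X → 𝒟.carrier) (νf : NormalField (𝓡 4) f), Manifold.IsSmoothEmbedding (𝓡 3) (𝓡 4) (⊤ : ℕ∞) f ∧ 𝒟.metric.IsCauchyHypersurface 𝒟.timeOrientation (range f) ∧ 𝒟.metric.IsFutureUnitNormal (𝓡 3) 𝒟.timeOrientation f νf ∧ ∃ Df : InitialDataSet (𝓡 3) X, (∀ (x : X) (v w : TangentSpace (𝓡 3) x), Df.h.inner x v w = 𝒟.metric.val (f x) (mfderiv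 (𝓡 3) (𝓡 4) f x v) (mfderiv (𝓡 3) (𝓡 4) f x w)) ∧ (∀ [𝒟.metric.toPseudoRiemannianMetric.HasLeviCivita] (x : X), 𝒟.metric.toPseudoRiemannianMetric.secondFundamentalForm (𝓡 3) f νf x = Df.kBilin x) ∧ Df.IsMaximalData ∧ (∀ [Df.metric.HasLeviCivita], Df.IsComplete) ∧ ∃ e : AFEnd X, e.IsSoleEnd ∧ e.IsAsymptoticallyFlat Df 1) → ∃ (F : ℝ × X → 𝒟.carrier) (ν : ∀ t : ℝ, NormalField (𝓡 4) (fun x : X ↦ F (t, x))), (ContMDiff (𝓘(ℝ, ℝ).prod (𝓡 3)) (𝓡 4) (⊤ : ℕ∞) F ∧ (∀ t, Manifold.IsSmoothEmbedding (𝓡 3) (𝓡 4) (⊤ : ℕ∞) (fun x ↦ F (t, x))) ∧ (∀ t, 𝒟.metric.IsCauchyHypersurface 𝒟.timeOrientation (range fun x ↦ F (t, x))) ∧ (∀ t, 𝒟.metric.IsFutureUnitNormal (𝓡 3) 𝒟.timeOrientation (fun x ↦ F (t, x)) (ν t)) ∧ (∀ t, ∃ Dt : InitialDataSet (𝓡 3)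 X, (∀ (x : X) (v w : TangentSpace (𝓡 3) x), Dt.h.inner x v w = 𝒟.metric.val (F (t, x)) (mfderiv (𝓡 3) (𝓡 4) (fun y ↦ F (t, y)) x v) (mfderiv (𝓡 3) (𝓡 4) (fun y ↦ F (t, y)) x w)) ∧ (∀ [𝒟.metric.toPseudoRiemannianMetric.HasLeviCivita] (x : X), 𝒟.metric.toPseudoRiemannianMetric.secondFundamentalForm (𝓡 3) (fun y ↦ F (t, y)) (ν t) x = Dt.kBilin x) ∧ Dt.IsMaximalData ∧ (∀ [Dt.metric.HasLeviCivita], Dt.IsComplete) ∧ ∃ e : AFEnd X, e.IsSoleEnd ∧ e.IsAsymptoticallyFlat Dt 1) ∧ (∀ t x, 0 < - 𝒟.metric.val (F (t, x)) (mfderiv 𝓘(ℝ, ℝ) (𝓡 4) (fun s : ℝ ↦ F (s, x)) t 1) (ν t x)) ∧ (∀ t, 0 ≤ t → Tendsto (fun x ↦ - 𝒟.metric.val (F (t, x)) (mfderiv 𝓘(ℝ, ℝ) (𝓡 4) (fun s : ℝ ↦ F (s, x)) t 1) (ν t x)) (cocompact X) (𝓝 1))) := by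
  sorry

/-! ## Composition: the crux BY NAME from the three stubs (real proof, no `sorry`) -/

/-- **MaximalCensorship from K, L, A** — monotonicity of tame Christodoulou genericity in the property:
a datum exceptional for the crux's property `P` is exceptional for K's property `Q` (pointwise on the
admissible class `Q → P`: L gives a maximal Cauchy leaf, A propagates it to a normalised maximal Cauchy
foliation, and K's `∀`-clause traps the wells of that foliation); K's tame, immersed, injective admissible
one-parameter family through the datum, all of whose other members satisfy `Q`, therefore has all other
members satisfying `P`. -/
theorem MaximalCensorship_of :
    Goal.stub_wellCensorshipGeneric → Goal.stub_maximalCauchyLeaf → Goal.stub_maximalLeafPropagates →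
      MaximalCensorship := by
  intro hK hL hA X _ _ _ _ _ _
  -- (1) monotonicity of tame Christodoulou genericity in the property
  have mono : ∀ {Q P : InitialDataSet (𝓡 3) X → Prop},
      (∀ D ∈ admissibleVacuumData X, Q D → P D) →
      InitialDataSet.IsTameChristodoulouGeneric (admissibleVacuumData X) Q 1 →
      InitialDataSet.IsTameChristodoulouGeneric (admissibleVacuumData X) P 1 := by
    intro Q P hQP hQ d hd
    obtain ⟨e, Fam, hF, hImm, h0, hinj, hD, hE⟩ := hQ d ⟨hd.1, fun hq ↦ hd.2 (hQP d hd.1 hq)⟩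
    exact ⟨e, Fam, hF, hImm, h0, hinj, hD,
      fun c hc hmem ↦ hE c hc ⟨hmem.1, fun hq ↦ hmem.2 (hQP _ hmem.1 hq)⟩⟩
  refine mono ?_ (hK X)
  -- (2) the pointwise upgrade `Q → P` on an admissible datum
  intro D hD hq
  refine ⟨hq.1, fun 𝒟 h𝒟 ↦ ?_⟩
  obtain ⟨hCNI, hW⟩ := hq.2 𝒟 h𝒟
  obtain ⟨F, ν, hFol⟩ := hA X D hD 𝒟 h𝒟 hCNI (hL X D hD 𝒟 h𝒟 hCNI)
  exact ⟨hCNI, F, ν, hFol, hW F ν hFol⟩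

/-- The crux by name, closed modulo the three registered stubs. -/
theorem MaximalCensorship_proof : MaximalCensorship :=
  MaximalCensorship_of stub_wellCensorshipGeneric stub_maximalCauchyLeaf stub_maximalLeafPropagates

/-! ### Consistency: each registered stub, stated EXPANDED, IS the named `Goal` statement (by `δ`/syntactic identity). -/

theorem goal_wellCensorshipGeneric_holds : Goal.stub_wellCensorshipGeneric := stub_wellCensorshipGeneric
theorem goal_maximalCauchyLeaf_holds : Goal.stub_maximalCauchyLeaf := stub_maximalCauchyLeaf
theorem goal_maximalLeafPropagates_holds : Goal.stub_maximalLeafPropagates := stub_maximalLeafPropagates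

/-- Logical position (sorry-free): the crux implies its `t`-independent censorship shadow only together with
uniqueness of the gauge, which is NOT claimed; but it does imply MGHD existence + complete `𝓘⁺` generically,
i.e. the route's shared conjunct in TAME typing — recorded here as the monotonicity instance it is. -/
theorem tameWeakCosmicCensorship_of_crux (h : MaximalCensorship) :
    ∀ (X : Type) [TopologicalSpace X] [ChartedSpace E3 X] [IsManifold (𝓡 3) (⊤ : ℕ∞) X] [T2Space X]
      [SecondCountableTopology X] [ConnectedSpace X],
      InitialDataSet.IsTameChristodoulouGeneric (admissibleVacuumData X)
        (fun D ↦ (∃ 𝒟 : VacuumCauchyDevelopment D, 𝒟.IsMaximal) ∧ ∀ 𝒟 : VacuumCauchyDevelopment D,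
          𝒟.IsMaximal → Summit.FinalStateConjecture.HasCompleteNullInfinity 𝒟.toCauchyDevelopment) 1 := by
  intro X _ _ _ _ _ _ d hd
  obtain ⟨e, Fam, hF, hImm, h0, hinj, hD, hE⟩ :=
    h X d ⟨hd.1, fun hp ↦ hd.2 ⟨hp.1, fun 𝒟 h𝒟 ↦ (hp.2 𝒟 h𝒟).1⟩⟩
  exact ⟨e, Fam, hF, hImm, h0, hinj, hD,
    fun c hc hmem ↦ hE c hc ⟨hmem.1, fun hp ↦ hmem.2 ⟨hp.1, fun 𝒟 h𝒟 ↦ (hp.2 𝒟 h𝒟).1⟩⟩⟩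

end Summit.FinalStateConjecture.FinalStateConjecture.Cruxes.MaximalCensorship.Birth

end
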